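import Literature.NumberTheory.DiophantineGeometry.PlaneCurveFiniteFibres
import Mathlib.Algebra.Polynomial.Degree.Domain
import Mathlib.Data.Fintype.EquivFin
import HarnessLib

/-!
# [GenEll] Thm. 2.1 for `ℙ¹`, the `D_e` route: critical-value collisions in the family `t_c`

S. Mochizuki, *Arithmetic elliptic curves in general position*, Math. J. Okayama Univ. 52 (2010)
[cite: MochizukiGenEll2010, Thm 2.1 p.12]: the proof of Thm. 2.1, (ii) ⇒ (i), needs a NONCRITICAL Belyi
map on the auxiliary curve, i.e. one whose reduced fibre over `{0,1,∞}` avoids prescribed points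
(p. 12, via [NCBelyi]).  In the number-field-only rendering used by the abc-iut cell for
`(ℙ¹, [0]+[1]+[∞])` (route item GenEllTwo of `Summit.ABC.ABC.Theses.IUTThetaPilot`, package map
GENELLTWO-P1ROUTE, repair R2′ of its §4) the curve is `D_e : r^e = x(1−x)` (`e = 2k+1`,
`s := 1 − 2x`) and the maps are `β ∘ t_c` for the FAMILY `t_c := 1/r + c·r^{k+1}/s` (`c ≠ 0`), with
ramification on the affine non-special locus cut out by
`N_c = r²s³·dt_c/dr = −s³ + c·((k+1) r^{k+2} − 2 r^{3k+3})`.  A Belyi map for the critical values of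
`t_c` can protect a point `P` unless `P` COLLIDES under `t_c` with a critical point; the
`x`-coordinates of such `P` form the PERSISTENT SET of `c`.  This file proves, by explicit algebra on
the plane curve (finiteness of `V(f, G)` for `f ∤ G` = the tree's `PlaneCurve.finite_commonZeros`,
`f = Y^{2k+1} − x(1−x)` irreducible by Eisenstein):

* `DeFamily.finite_collisionParams` — for a non-special `P` the set of `c` making `P` collide with a
  `t_c`-critical point is FINITE (`k ≥ 3`; eliminating `c` gives a `c`-free curve `Φ_P = 0` with
  `Φ_P = f·q + R_P`, `deg_r R_P = k+3 < e`, `R_P ≠ 0`);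
* `DeFamily.finite_persistentSet` — for `c ≠ 0` the persistent set is FINITE (`k ≥ 2`).

The choice of finitely many parameters with pairwise disjoint persistent sets (the input of the
cell's `vojtaIneq_univ_of_persistent`) is the sequel `GenEllDePersistentFamily`.  Conventions = the
cell's `(x, r)`-coordinates (cf. `GenEllDeRamificationArch`); the only definitions are the point
predicates `OnCurve`, `NonSpecial`, `N`, `Collide`, `persistentSet` and polynomial/evaluation
plumbing.  Classical algebra; nothing here bears on the disputed parts of the abc-iut corpus.
-/

noncomputable section

open Polynomial

namespace Literature.NumberTheory.DiophantineGeometry.GenEll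

namespace DeFamily

variable {Ω : Type*} [Field Ω]

/-! ### The point predicates of the family `t_c` on `D_e : r^{2k+1} = x(1−x)` -/

/-- `P = (x, r)` lies on `D_e`: `r^{2k+1} = x(1 − x)`. [cite: MochizukiGenEll2010, Thm 2.1 p.12] -/
def OnCurve (k : ℕ) (P : Ω × Ω) : Prop := P.2 ^ (2 * k + 1) = P.1 * (1 - P.1)

/-- `P = (x, r)` is a non-special affine point of `D_e`: `r ≠ 0` (not `Q_0, Q_1`) and `s = 1 − 2x ≠ 0`
(not a Weierstrass point). [cite: MochizukiGenEll2010, Thm 2.1 p.12] -/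
def NonSpecial (P : Ω × Ω) : Prop := P.2 ≠ 0 ∧ 1 - 2 * P.1 ≠ 0

/-- The ramification form of `t_c = 1/r + c·r^{k+1}/s`:
`N_c(x, r) = −(1−2x)³ + c·((k+1) r^{k+2} − 2 r^{3k+3})` (`= r²s³·dt_c/dr` on the curve).
[cite: MochizukiGenEll2010, Thm 2.1 p.12] -/
def N (k : ℕ) (c : Ω) (Q : Ω × Ω) : Ω :=
  -(1 - 2 * Q.1) ^ 3 + c * (((k : Ω) + 1) * Q.2 ^ (k + 2) - 2 * Q.2 ^ (3 * k + 3))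

/-- `P` and `Q` COLLIDE under `t_c` (denominator-free form of `t_c(P) = t_c(Q)`):
`(r_P − r_Q)·s_P·s_Q = c·r_P·r_Q·(r_P^{k+1} s_Q − r_Q^{k+1} s_P)`. [cite: MochizukiGenEll2010, Thm 2.1 p.12] -/
def Collide (k : ℕ) (c : Ω) (P Q : Ω × Ω) : Prop :=
  (P.2 - Q.2) * (1 - 2 * P.1) * (1 - 2 * Q.1) =
    c * P.2 * Q.2 * (P.2 ^ (k + 1) * (1 - 2 * Q.1) - Q.2 ^ (k + 1) * (1 - 2 * P.1))

/-- The PERSISTENT SET of the family member `c`: the `x`-coordinates of the non-special points of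
`D_e(Ω)` colliding under `t_c` with a `t_c`-critical point (`N_c(Q) = 0`) — the points no Belyi map
for the critical values of `t_c` can protect. [cite: MochizukiGenEll2010, Thm 2.1 p.12] -/
def persistentSet (k : ℕ) (c : Ω) : Set Ω :=
  {a | ∃ P : Ω × Ω, P.1 = a ∧ OnCurve k P ∧ NonSpecial P ∧
    ∃ Q : Ω × Ω, OnCurve k Q ∧ N k c Q = 0 ∧ Collide k c P Q}

/-! ### Algebra on the curve -/

/-- On the curve: `s² = 1 − 4 r^e`. [cite: MochizukiGenEll2010, Thm 2.1 p.12] -/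
theorem sq_s_eq {k : ℕ} {P : Ω × Ω} (hP : OnCurve k P) :
    (1 - 2 * P.1) ^ 2 = 1 - 4 * P.2 ^ (2 * k + 1) := by
  unfold OnCurve at hP
  linear_combination (4 : Ω) * hP

variable [CharZero Ω]

/-- A `t_c`-critical point has `M(r_Q) := (k+1) r_Q^{k+2} − 2 r_Q^{3k+3} ≠ 0` (otherwise `s_Q = 0`,
`4 r_Q^e = 1` and `2·M(r_Q) = (2k+1)·r_Q^{k+2} ≠ 0`). [cite: MochizukiGenEll2010, Thm 2.1 p.12] -/
theorem M_ne_zero_of_N_eq_zero {k : ℕ} {c : Ω} {Q : Ω × Ω} (hQ : OnCurve k Q) (hN : N k c Q = 0) :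
    ((k : Ω) + 1) * Q.2 ^ (k + 2) - 2 * Q.2 ^ (3 * k + 3) ≠ 0 := by
  intro hM
  have hs3 : (1 - 2 * Q.1) ^ 3 = 0 := by
    unfold N at hN; rw [hM, mul_zero, add_zero, neg_eq_zero] at hN; exact hN
  have hs : 1 - 2 * Q.1 = 0 := pow_eq_zero_iff (n := 3) (by norm_num) |>.mp hs3
  have h4 : 4 * Q.2 ^ (2 * k + 1) = 1 := by
    have := sq_s_eq hQ
    rw [hs] at this
    linear_combination this
  have hr : Q.2 ≠ 0 := by
    intro h0; rw [h0, zero_pow (by omega), mul_zero] at h4; exact zero_ne_one h4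
  -- `2·M = r^{k+2}·(2(k+1) − 4 r^{2k+1}) = r^{k+2}·(2k+1)`
  have h2M : 2 * (((k : Ω) + 1) * Q.2 ^ (k + 2) - 2 * Q.2 ^ (3 * k + 3)) =
      Q.2 ^ (k + 2) * (2 * (k : Ω) + 1) := by
    have hp : Q.2 ^ (3 * k + 3) = Q.2 ^ (k + 2) * Q.2 ^ (2 * k + 1) := by ring
    rw [hp]
    linear_combination (-(Q.2 ^ (k + 2))) * h4
  rw [hM, mul_zero] at h2M
  have hk : (2 * (k : Ω) + 1) ≠ 0 := by
    have : (2 * (k : Ω) + 1) = ((2 * k + 1 : ℕ) : Ω) := by push_cast; ring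
    rw [this]; exact Nat.cast_ne_zero.mpr (by omega)
  exact (mul_ne_zero (pow_ne_zero _ hr) hk) h2M.symm

/-- A `t_c`-critical point with `c ≠ 0` is non-special. [cite: MochizukiGenEll2010, Thm 2.1 p.12] -/
theorem nonSpecial_of_N_eq_zero {k : ℕ} {c : Ω} (hc : c ≠ 0) {Q : Ω × Ω} (hQ : OnCurve k Q)
    (hN : N k c Q = 0) : NonSpecial Q := by
  have hM := M_ne_zero_of_N_eq_zero hQ hN
  refine ⟨fun hr => hM ?_, fun hs => hM ?_⟩
  · rw [hr, zero_pow (by omega), zero_pow (by omega), mul_zero, mul_zero, sub_zero]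
  · -- `s = 0` ⇒ `c·M = s³ = 0` ⇒ `M = 0`
    have : c * (((k : Ω) + 1) * Q.2 ^ (k + 2) - 2 * Q.2 ^ (3 * k + 3)) = 0 := by
      unfold N at hN; rw [hs] at hN; linear_combination hN
    exact (mul_eq_zero.mp this).resolve_left hc

/-! ### Bivariate polynomials: evaluation plumbing (outer variable `r`, inner variable `x`) -/

end DeFamily

namespace DeFamily

variable {Ω : Type*} [Field Ω]

/-- The affine equation of `D_e` as a bivariate polynomial, `f = Y^{2k+1} − C(x(1−x)) ∈ Ω[x][Y]`
(outer variable `Y = r`). [cite: MochizukiGenEll2010, Thm 2.1 p.12] -/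
def curvePoly (k : ℕ) : Ω[X][X] := X ^ (2 * k + 1) - C (X * (1 - X))

/-- Evaluation of a bivariate polynomial at a point `z = (a, b)` (inner variable `x ↦ a`, then
`Y ↦ b`), the convention of `PlaneCurve.finite_commonZeros`. [cite: MochizukiGenEll2010, Thm 2.1 p.12] -/
def ev (z : Ω × Ω) (G : Ω[X][X]) : Ω := (G.map (aeval z.1).toRingHom).eval z.2

/-- `ev` is a ring homomorphism in `G` (file plumbing). [cite: MochizukiGenEll2010, Thm 2.1 p.12] -/
theorem ev_eq_eval₂ (z : Ω × Ω) (G : Ω[X][X]) :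
    ev z G = eval₂ (aeval z.1).toRingHom z.2 G := by
  rw [ev, eval_map]

/-- Evaluation of the curve polynomial: `ev z f = r^{2k+1} − x(1−x)`. [cite: MochizukiGenEll2010, Thm 2.1 p.12] -/
theorem ev_curvePoly (k : ℕ) (z : Ω × Ω) :
    ev z (curvePoly k) = z.2 ^ (2 * k + 1) - z.1 * (1 - z.1) := by
  simp [ev, curvePoly, Polynomial.map_sub, Polynomial.map_pow, Polynomial.map_mul]

/-- A nonzero bivariate polynomial of `Y`-degree `< 2k+1` is not a multiple of the curve polynomial
(which is monic of `Y`-degree `2k+1`). [cite: MochizukiGenEll2010, Thm 2.1 p.12] -/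
theorem not_dvd_of_natDegree_lt (k : ℕ) {G : Ω[X][X]} (hG0 : G ≠ 0)
    (hdeg : G.natDegree < 2 * k + 1) : ¬ curvePoly k ∣ G := by
  intro h
  have := natDegree_le_of_dvd h hG0
  rw [curvePoly, natDegree_X_pow_sub_C] at this
  omega

/-- `V(f, G)(Ω)` is finite as soon as `G = f·q + R` with `R ≠ 0` of `Y`-degree `< 2k+1`
(`f = Y^{2k+1} − x(1−x)` is irreducible — Eisenstein at `x` — so `f ∤ G` makes `f, G` coprime in
`Ω(x)[Y]`, and two plane curves without common component meet finitely; tree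
`PlaneCurve.finite_commonZeros`). [cite: MochizukiGenEll2010, Thm 2.1 p.12] -/
theorem finite_commonZeros_of_reduction (k : ℕ) (hk : 0 < k) (G q R : Ω[X][X])
    (hGR : G = curvePoly k * q + R) (hR0 : R ≠ 0) (hRdeg : R.natDegree < 2 * k + 1) :
    Set.Finite {z : Ω × Ω | ev z (curvePoly k) = 0 ∧ ev z G = 0} := by
  have he : 0 < 2 * k + 1 := by omega
  have hmonic : (curvePoly k : Ω[X][X]).Monic := monic_X_pow_sub_C _ (by omega)
  have hnd : ¬ curvePoly k ∣ G := by
    intro h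
    have hR : curvePoly k ∣ R := by
      have : R = G - curvePoly k * q := by rw [hGR]; ring
      rw [this]; exact dvd_sub h (dvd_mul_right _ q)
    exact not_dvd_of_natDegree_lt k hR0 hRdeg hR
  have hdeg : (curvePoly k : Ω[X][X]).natDegree ≠ 0 := by
    rw [curvePoly, natDegree_X_pow_sub_C]; omega
  exact PlaneCurve.finite_commonZeros (K := Ω) (Ω := Ω) (curvePoly k) G hmonic hdeg
    (PlaneCurve.isCoprime_map_of_irreducible (curvePoly k) G hmonic
      (PlaneCurve.irreducible_X_pow_sub_C_X_mul_one_sub_X (2 * k + 1) he) hnd)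

/-- `ev` as a ring homomorphism (file plumbing). [cite: MochizukiGenEll2010, Thm 2.1 p.12] -/
def evHom (z : Ω × Ω) : Ω[X][X] →+* Ω := eval₂RingHom (aeval z.1).toRingHom z.2

/-- [cite: MochizukiGenEll2010, Thm 2.1 p.12] -/
theorem ev_eq_evHom (z : Ω × Ω) (G : Ω[X][X]) : ev z G = evHom z G := by rw [ev, eval_map]; rfl

/-- [cite: MochizukiGenEll2010, Thm 2.1 p.12] -/
@[simp] theorem evHom_X (z : Ω × Ω) : evHom z (X : Ω[X][X]) = z.2 := eval₂_X _ _

/-- [cite: MochizukiGenEll2010, Thm 2.1 p.12] -/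
@[simp] theorem evHom_C (z : Ω × Ω) (p : Ω[X]) : evHom z (C p) = aeval z.1 p := eval₂_C _ _

/-- The curve polynomial with the inner constant pushed through `C`. [cite: MochizukiGenEll2010, Thm 2.1 p.12] -/
theorem curvePoly_eq (k : ℕ) : (curvePoly k : Ω[X][X]) = X ^ (2 * k + 1) - C X * (1 - C X) := by
  simp [curvePoly, map_mul, map_sub]

/-! ### (1) For a fixed non-special point `P`, finitely many collision parameters -/

/-- The `c`-FREE collision curve of a non-special point `P = (x_P, ρ)`, `σ := 1 − 2x_P`:
`Φ_P(x, r) = (ρ − r)·σ·s·M(r) − s³·ρ·r·(ρ^{k+1} s − r^{k+1} σ)`, `s = 1 − 2x`,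
`M(r) = (k+1) r^{k+2} − 2 r^{3k+3}` — obtained from «`Q` critical for `t_c`» (`c·M(r_Q) = s_Q³`) and
«`P, Q` collide under `t_c`» by eliminating `c`. [cite: MochizukiGenEll2010, Thm 2.1 p.12] -/
def collisionPoly (k : ℕ) (ρ σ : Ω) : Ω[X][X] :=
  (C (C ρ) - X) * C (C σ) * (1 - 2 * C X) *
      (((k : Ω[X][X]) + 1) * X ^ (k + 2) - 2 * X ^ (3 * k + 3)) -
    (1 - 2 * C X) ^ 3 * C (C ρ) * X * (C (C ρ) ^ (k + 1) * (1 - 2 * C X) - X ^ (k + 1) * C (C σ))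

/-- Value of `Φ_P` at a point `Q = (x, r)`. [cite: MochizukiGenEll2010, Thm 2.1 p.12] -/
theorem ev_collisionPoly (k : ℕ) (ρ σ : Ω) (z : Ω × Ω) :
    ev z (collisionPoly k ρ σ) =
      (ρ - z.2) * σ * (1 - 2 * z.1) * (((k : Ω) + 1) * z.2 ^ (k + 2) - 2 * z.2 ^ (3 * k + 3)) -
        (1 - 2 * z.1) ^ 3 * ρ * z.2 * (ρ ^ (k + 1) * (1 - 2 * z.1) - z.2 ^ (k + 1) * σ) := by
  rw [ev_eq_evHom]
  simp only [collisionPoly, map_sub, map_mul, map_add, map_pow, map_natCast, map_one, map_ofNat,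
    evHom_X, evHom_C, aeval_X, aeval_C, Algebra.algebraMap_self_apply]

/-- The REMAINDER of `Φ_P` modulo the curve polynomial:
`R_P = A·r^{k+2} + B·r^{k+3} − D·r` with `B = σ·(1−2x)·(2x(1−x) − (k+1))`.
[cite: MochizukiGenEll2010, Thm 2.1 p.12] -/
def collisionRem (k : ℕ) (ρ σ : Ω) : Ω[X][X] :=
  C (C σ * (1 - 2 * X) * (C ((k : Ω) + 1) * C ρ) - 2 * C σ * (1 - 2 * X) * C ρ * (X * (1 - X)) +
        C ρ * C σ * (1 - 2 * X) ^ 3) * X ^ (k + 2) +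
    C (C σ * (1 - 2 * X) * (2 * (X * (1 - X)) - C ((k : Ω) + 1))) * X ^ (k + 3) -
      C (C (ρ ^ (k + 2)) * (1 - 2 * X) ^ 4) * X

/-- Division with remainder: `Φ_P = f · (2σ·s·r^{k+2}·(r − ρ)) + R_P`.
[cite: MochizukiGenEll2010, Thm 2.1 p.12] -/
theorem collisionPoly_eq (k : ℕ) (ρ σ : Ω) :
    collisionPoly k ρ σ =
      curvePoly k * (2 * C (C σ) * (1 - 2 * C X) * X ^ (k + 2) * (X - C (C ρ))) +
        collisionRem k ρ σ := by
  rw [curvePoly_eq]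
  simp only [collisionPoly, collisionRem, map_mul, map_sub, map_add, map_pow, map_natCast,
    map_one, map_ofNat]
  have h3 : (X : Ω[X][X]) ^ (3 * k + 3) = X ^ (2 * k + 1) * X ^ (k + 2) := by
    rw [← pow_add]; congr 1; ring
  rw [h3]
  ring

/-- The remainder has `Y`-degree `≤ k + 3`. [cite: MochizukiGenEll2010, Thm 2.1 p.12] -/
theorem natDegree_collisionRem_le (k : ℕ) (ρ σ : Ω) :
    (collisionRem k ρ σ).natDegree ≤ k + 3 := by
  unfold collisionRem
  refine (natDegree_sub_le _ _).trans (max_le ((natDegree_add_le _ _).trans (max_le ?_ ?_)) ?_)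
  · exact (natDegree_C_mul_X_pow_le _ _).trans (by omega)
  · exact natDegree_C_mul_X_pow_le _ _
  · exact ((natDegree_C_mul_le _ _).trans natDegree_X_le).trans (by omega)

/-- The remainder is nonzero when `σ ≠ 0`: its `r^{k+3}`-coefficient `σ·(1−2x)·(2x(1−x) − (k+1))`
takes the value `−(k+1)·σ ≠ 0` at `x = 0`. [cite: MochizukiGenEll2010, Thm 2.1 p.12] -/
theorem collisionRem_ne_zero [CharZero Ω] (k : ℕ) (ρ : Ω) {σ : Ω} (hσ : σ ≠ 0) :
    collisionRem k ρ σ ≠ 0 := by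
  intro h0
  have hc : ((collisionRem k ρ σ).coeff (k + 3)).eval 0 = 0 := by rw [h0, coeff_zero, eval_zero]
  rw [collisionRem, coeff_sub, coeff_add, coeff_C_mul_X_pow, coeff_C_mul_X_pow, coeff_C_mul_X,
    if_neg (show k + 3 ≠ k + 2 by omega), if_pos rfl, if_neg (show k + 3 ≠ 1 by omega), zero_add,
    sub_zero] at hc
  simp only [eval_mul, eval_sub, eval_C, eval_X, eval_one, eval_ofNat, mul_zero, sub_zero, mul_one,
    zero_sub, mul_neg, neg_eq_zero, mul_eq_zero] at hc
  have hk : ((k : Ω) + 1) ≠ 0 := by exact_mod_cast Nat.succ_ne_zero k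
  rcases hc with hc | hc
  · exact hσ hc
  · exact hk hc

/-- **(1) Finitely many collision parameters.** For `k ≥ 3` and a NON-SPECIAL point `P` (it need
not even lie on the curve), the set of parameters `c ∈ Ω` for which `P` collides under `t_c` with a
`t_c`-critical point of `D_e(Ω)` is finite. [cite: MochizukiGenEll2010, Thm 2.1 p.12] -/
theorem finite_collisionParams [CharZero Ω] {k : ℕ} (hk : 3 ≤ k) {P : Ω × Ω}
    (hPns : NonSpecial P) :
    Set.Finite {c : Ω | ∃ Q : Ω × Ω, OnCurve k Q ∧ N k c Q = 0 ∧ Collide k c P Q} := by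
  obtain ⟨hρ, hσ⟩ := hPns
  -- the finite set `V(f, Φ_P)`
  have hV : Set.Finite {z : Ω × Ω | ev z (curvePoly k) = 0 ∧
      ev z (collisionPoly k P.2 (1 - 2 * P.1)) = 0} :=
    finite_commonZeros_of_reduction k (by omega) _ _ _ (collisionPoly_eq k P.2 (1 - 2 * P.1))
      (collisionRem_ne_zero k P.2 hσ) ((natDegree_collisionRem_le k _ _).trans_lt (by omega))
  -- every collision parameter is `s_Q³ / M(r_Q)` for a point `Q ∈ V(f, Φ_P)`
  refine (hV.image fun Q : Ω × Ω =>
    (1 - 2 * Q.1) ^ 3 / (((k : Ω) + 1) * Q.2 ^ (k + 2) - 2 * Q.2 ^ (3 * k + 3))).subset ?_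
  rintro c ⟨Q, hQ, hN, hcol⟩
  have hM := M_ne_zero_of_N_eq_zero hQ hN
  refine ⟨Q, ⟨?_, ?_⟩, ?_⟩
  · rw [ev_curvePoly, hQ, sub_self]
  · rw [ev_collisionPoly]
    unfold Collide at hcol
    unfold N at hN
    linear_combination (((k : Ω) + 1) * Q.2 ^ (k + 2) - 2 * Q.2 ^ (3 * k + 3)) * hcol +
      (P.2 * Q.2 * (P.2 ^ (k + 1) * (1 - 2 * Q.1) - Q.2 ^ (k + 1) * (1 - 2 * P.1))) * hN
  · rw [div_eq_iff hM]
    unfold N at hN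
    linear_combination -hN

/-! ### (2) For a fixed parameter `c ≠ 0`, the persistent set is finite -/

/-- `N_c` as a bivariate polynomial. [cite: MochizukiGenEll2010, Thm 2.1 p.12] -/
def NPoly (k : ℕ) (c : Ω) : Ω[X][X] :=
  -(1 - 2 * C X) ^ 3 + C (C c) * (((k : Ω[X][X]) + 1) * X ^ (k + 2) - 2 * X ^ (3 * k + 3))

/-- [cite: MochizukiGenEll2010, Thm 2.1 p.12] -/
theorem ev_NPoly (k : ℕ) (c : Ω) (z : Ω × Ω) : ev z (NPoly k c) = N k c z := by
  rw [ev_eq_evHom]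
  simp only [NPoly, N, map_sub, map_mul, map_add, map_pow, map_natCast, map_one, map_ofNat, map_neg,
    evHom_X, evHom_C, aeval_X, aeval_C, Algebra.algebraMap_self_apply]

/-- The remainder of `N_c` modulo the curve polynomial: `−(1−2x)³ + c·((k+1) − 2x(1−x))·r^{k+2}`.
[cite: MochizukiGenEll2010, Thm 2.1 p.12] -/
def NRem (k : ℕ) (c : Ω) : Ω[X][X] :=
  C (-(1 - 2 * X) ^ 3) + C (C c * (C ((k : Ω) + 1) - 2 * (X * (1 - X)))) * X ^ (k + 2)

/-- `N_c = f · (−2c·r^{k+2}) + NRem`. [cite: MochizukiGenEll2010, Thm 2.1 p.12] -/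
theorem NPoly_eq (k : ℕ) (c : Ω) :
    NPoly k c = curvePoly k * (-2 * C (C c) * X ^ (k + 2)) + NRem k c := by
  rw [curvePoly_eq]
  simp only [NPoly, NRem, map_mul, map_sub, map_add, map_pow, map_natCast, map_one, map_ofNat,
    map_neg]
  have h3 : (X : Ω[X][X]) ^ (3 * k + 3) = X ^ (2 * k + 1) * X ^ (k + 2) := by
    rw [← pow_add]; congr 1; ring
  rw [h3]
  ring

/-- [cite: MochizukiGenEll2010, Thm 2.1 p.12] -/
theorem natDegree_NRem_le (k : ℕ) (c : Ω) : (NRem k c).natDegree ≤ k + 2 :=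
  (natDegree_add_le _ _).trans (max_le (by rw [natDegree_C]; exact Nat.zero_le _)
    (natDegree_C_mul_X_pow_le _ _))

/-- `NRem ≠ 0`: its constant coefficient is `−(1−2x)³`, with value `−1` at `x = 0`.
[cite: MochizukiGenEll2010, Thm 2.1 p.12] -/
theorem NRem_ne_zero (k : ℕ) (c : Ω) : NRem k c ≠ 0 := by
  intro h0
  have hc : ((NRem k c).coeff 0).eval 0 = 0 := by rw [h0, coeff_zero, eval_zero]
  rw [NRem, coeff_add, coeff_C_zero, coeff_C_mul_X_pow, if_neg (show 0 ≠ k + 2 by omega),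
    add_zero] at hc
  norm_num at hc

/-- The set of `t_c`-critical points of `D_e(Ω)` is finite (`k ≥ 2`).
[cite: MochizukiGenEll2010, Thm 2.1 p.12] -/
theorem finite_critical {k : ℕ} (hk : 2 ≤ k) (c : Ω) :
    Set.Finite {Q : Ω × Ω | OnCurve k Q ∧ N k c Q = 0} := by
  have hV := finite_commonZeros_of_reduction k (by omega) _ _ _ (NPoly_eq k c) (NRem_ne_zero k c)
    ((natDegree_NRem_le k c).trans_lt (by omega))
  refine hV.subset fun Q ⟨hQ, hN⟩ => ⟨?_, ?_⟩
  · rw [ev_curvePoly, hQ, sub_self]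
  · rw [ev_NPoly, hN]

/-- The collision relation with a FIXED point `Q = (x_Q, r_Q)` (`s_Q = 1 − 2x_Q`), as a polynomial in
the coordinates of `P`: `Ψ_Q = (−c r_Q s_Q)·r^{k+2} + (s·s_Q + c·r_Q^{k+2}·s)·r − r_Q s_Q·s`.
[cite: MochizukiGenEll2010, Thm 2.1 p.12] -/
def fibrePoly (k : ℕ) (c rQ sQ : Ω) : Ω[X][X] :=
  C (C (-(c * rQ * sQ))) * X ^ (k + 2) +
    C ((1 - 2 * X) * C sQ + C (c * rQ ^ (k + 2)) * (1 - 2 * X)) * X - C (C (rQ * sQ) * (1 - 2 * X))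

/-- `Ψ_Q(P) = 0` iff `P` and `Q` collide under `t_c`. [cite: MochizukiGenEll2010, Thm 2.1 p.12] -/
theorem ev_fibrePoly (k : ℕ) (c : Ω) (Q P : Ω × Ω) :
    ev P (fibrePoly k c Q.2 (1 - 2 * Q.1)) =
      (P.2 - Q.2) * (1 - 2 * P.1) * (1 - 2 * Q.1) -
        c * P.2 * Q.2 * (P.2 ^ (k + 1) * (1 - 2 * Q.1) - Q.2 ^ (k + 1) * (1 - 2 * P.1)) := by
  rw [ev_eq_evHom]
  simp only [fibrePoly, map_sub, map_mul, map_add, map_pow, map_one, map_ofNat, map_neg,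
    evHom_X, evHom_C, aeval_X, aeval_C, Algebra.algebraMap_self_apply]
  ring

/-- [cite: MochizukiGenEll2010, Thm 2.1 p.12] -/
theorem natDegree_fibrePoly_le (k : ℕ) (c rQ sQ : Ω) : (fibrePoly k c rQ sQ).natDegree ≤ k + 2 := by
  unfold fibrePoly
  refine (natDegree_sub_le _ _).trans (max_le ((natDegree_add_le _ _).trans (max_le
    (natDegree_C_mul_X_pow_le _ _) ?_)) ?_)
  · exact ((natDegree_C_mul_le _ _).trans natDegree_X_le).trans (by omega)
  · rw [natDegree_C]; exact Nat.zero_le _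

/-- `Ψ_Q ≠ 0` for `c, r_Q, s_Q ≠ 0` (top coefficient `−c r_Q s_Q`). [cite: MochizukiGenEll2010, Thm 2.1 p.12] -/
theorem fibrePoly_ne_zero (k : ℕ) {c rQ sQ : Ω} (hc : c ≠ 0) (hr : rQ ≠ 0) (hs : sQ ≠ 0) :
    fibrePoly k c rQ sQ ≠ 0 := by
  intro h0
  have hco : (fibrePoly k c rQ sQ).coeff (k + 2) = 0 := by rw [h0, coeff_zero]
  rw [fibrePoly, coeff_sub, coeff_add, coeff_C_mul_X_pow, if_pos rfl, coeff_C_mul_X,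
    if_neg (show k + 2 ≠ 1 by omega), coeff_C, if_neg (show k + 2 ≠ 0 by omega), add_zero,
    sub_zero, map_neg, neg_eq_zero, map_eq_zero] at hco
  exact mul_ne_zero (mul_ne_zero hc hr) hs hco

/-- **(2) The persistent set of a family member is finite.** For `k ≥ 2` and `c ≠ 0`, the set of
`x`-coordinates of non-special points of `D_e(Ω)` colliding under `t_c` with a `t_c`-critical point
is finite. [cite: MochizukiGenEll2010, Thm 2.1 p.12] -/
theorem finite_persistentSet [CharZero Ω] {k : ℕ} (hk : 2 ≤ k) {c : Ω} (hc : c ≠ 0) :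
    (persistentSet k c).Finite := by
  have hcrit := finite_critical hk c
  -- for each critical `Q`, the colliding points form the finite set `V(f, Ψ_Q)`
  have hfib : ∀ Q ∈ {Q : Ω × Ω | OnCurve k Q ∧ N k c Q = 0},
      Set.Finite {P : Ω × Ω | ev P (curvePoly k) = 0 ∧ ev P (fibrePoly k c Q.2 (1 - 2 * Q.1)) = 0} := by
    rintro Q ⟨hQ, hN⟩
    obtain ⟨hr, hs⟩ := nonSpecial_of_N_eq_zero hc hQ hN
    exact finite_commonZeros_of_reduction k (by omega) _ 0 _ (by rw [mul_zero, zero_add])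
      (fibrePoly_ne_zero k hc hr hs) ((natDegree_fibrePoly_le k c _ _).trans_lt (by omega))
  refine (hcrit.biUnion fun Q hQ => (hfib Q hQ).image Prod.fst).subset ?_
  rintro a ⟨P, rfl, hP, -, Q, hQ, hN, hcol⟩
  simp only [Set.mem_iUnion, Set.mem_image, Set.mem_setOf_eq]
  refine ⟨Q, ⟨hQ, hN⟩, P, ⟨?_, ?_⟩, rfl⟩
  · rw [ev_curvePoly, hP, sub_self]
  · rw [ev_fibrePoly]
    unfold Collide at hcol
    linear_combination hcol

end DeFamily

end Literature.NumberTheory.DiophantineGeometry.GenEll
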